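import Summits.PneNP.PneNP.Theorems.CodingVolumeShiftsCodingVolumeEffective

/-!
# Route CodingVolumeShifts — crux `CodingVolume` (stmt-PneNP-19454): the DEPARTURE lemma for
# general one-shot codes

Semantic (code-level) form of the departure step of the `C = 4` volume argument, for an ARBITRARY
binary one-shot code `c : N.Code` (no linearity). An arc is EFFECTIVE when its bit is not constant
(`∃ y y', c.val a y ≠ c.val a y'`); a MIDDLE vertex is neither a source nor a sink. Fix a finite set
`A1` of commodities each of which enters the middle of the network through effective arcs into ONE
middle vertex only (its entry vertex; hypothesis `hA1u`), and for a middle vertex `u` call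
BLOCK of `u` the commodities of `A1` entering at `u`.

* `codingVolume_val_eq_of_agree_entry` — OUT-SUPPORT AT LEVEL `r`: an arc leaving a middle vertex
  `u` of rank `r` carries the same bit on two inputs that agree on every commodity with an
  effective arc into `u` and on every commodity of level `< r` (level `hr j` = least rank of a
  middle vertex receiving an effective arc from `source j`; only its minimality `hhr` is used).
* `codingVolume_entry_lemmaM` — LEMMA M: if two inputs agree outside the block of `u` and the arcs
  from `u` into middle vertices carry the same bits on both, then EVERY arc whose tail is a middle
  vertex other than `u` carries the same bit on both (rank induction on locality: information of
  the block enters the middle of the network only at `u`).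
* `codingVolume_entry_decode` — hence, in a `4`-far network, such inputs agree on the block of `u`
  (decode at `sink i`: a source of the block adjacent to `sink i`, or an arc `u → sink i`, would put
  `source i` within distance `3` of `sink i`).
* `codingVolume_departure` — **DEPARTURE** (hybrid argument): with `A1` the level-`r` commodities
  having a unique entry vertex, two inputs that agree on the commodities of level `< r` and on the
  level-`r` commodities outside `A1`, and whose arcs from rank-`r` middle vertices into middle
  vertices carry the same bits, agree on `A1` — all the information of `A1` DEPARTS along those
  arcs.

No definitions; every set is spelled out. [folklore]
-/

set_option linter.dupNamespace false -- `Summit.PneNP.PneNP.…`: summit = sub-problem name (D-0017)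

namespace Summit.PneNP.PneNP.Theorems

open Literature.InformationTheory.NetworkCoding Finset

section Departure

variable {ι : Type} {N : KPairsNet ι}

/-- **OUT-SUPPORT AT LEVEL `r`.** Let `hr j` be at most the rank of every middle vertex receiving
an effective arc from `source j` (`hhr`). An arc `b` leaving a middle vertex of rank `r` carries
the same bit on two inputs that agree on every commodity having an effective arc into the tail of
`b` and on every commodity `j` with `hr j < r` (LOCALITY at the tail: its in-arcs come from sources
— effective, hence agreed, or constant — or from middle vertices of rank `< r`, whose bits only
depend on commodities of level `< r` by the support lemma). [folklore] -/
theorem codingVolume_val_eq_of_agree_entry (c : N.Code) (hr : ι → ℕ)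
    (hhr : ∀ i a, N.src a = N.source i → (∀ l, N.tgt a ≠ N.sink l) →
      (∃ y y' : ι → Bool, c.val a y ≠ c.val a y') → hr i ≤ N.rank (N.tgt a))
    (r : ℕ) (b : N.A) (hbM : ∀ j, N.src b ≠ N.source j) (hbr : N.rank (N.src b) = r)
    {x x' : ι → Bool}
    (hx : ∀ j, ((∃ a, N.src a = N.source j ∧ N.tgt a = N.src b ∧
      ∃ y y' : ι → Bool, c.val a y ≠ c.val a y') ∨ hr j < r) → x j = x' j) :
    c.val b x = c.val b x' := by
  refine c.local_ b x x' (fun a ha => ?_) (fun j hj => absurd hj.symm (hbM j))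
  by_cases hsa : ∃ j, N.src a = N.source j
  · obtain ⟨j, hj⟩ := hsa
    by_cases heff : ∃ y y' : ι → Bool, c.val a y ≠ c.val a y'
    · exact codingVolume_source_arc_depends c a hj x x' (hx j (Or.inl ⟨a, hj, ha, heff⟩))
    · push Not at heff
      exact heff x x'
  · push Not at hsa
    -- `a` leaves a middle vertex of rank `< r`
    have hlt : N.rank (N.src a) < r := by rw [← hbr, ← ha]; exact N.rank_lt a
    cases r with
    | zero => exact absurd hlt (Nat.not_lt_zero _)
    | succ r' =>
      refine codingVolume_val_eq_of_agree_effective c r' (fun j hj => hx j (Or.inr ?_)) a hsa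
        (Nat.lt_succ_iff.mp hlt)
      obtain ⟨a', ha', hM', hrk, heff'⟩ := hj
      exact Nat.lt_succ_of_le ((hhr j a' ha' hM' heff').trans hrk)

/-- **LEMMA M (rank induction).** Let `A1` be a set of commodities each entering the middle of the
network through effective arcs into a single middle vertex (`hA1u`), and let `u` be a vertex that
is not a sink. If two inputs agree on every commodity outside the BLOCK of `u` (the commodities of
`A1` with an effective arc into `u`), and every arc from `u` into a non-sink carries the same bit on
both, then every arc whose tail is a middle vertex other than `u` carries the same bit on both: the
in-arcs of such a tail come from `u` (agreed), from other middle vertices (induction on the rank),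
or from sources `j` — constant, or `j` outside the block (agreed), or `j` in the block, whose
effective arcs all end at `u`. [folklore] -/
theorem codingVolume_entry_lemmaM (c : N.Code) (A1 : Finset ι)
    (hA1u : ∀ j ∈ A1, ∀ a a', N.src a = N.source j → N.src a' = N.source j →
      (∀ l, N.tgt a ≠ N.sink l) → (∀ l, N.tgt a' ≠ N.sink l) →
      (∃ y y' : ι → Bool, c.val a y ≠ c.val a y') → (∃ y y' : ι → Bool, c.val a' y ≠ c.val a' y') →
      N.tgt a = N.tgt a')
    (u : N.V) (huM : ∀ l, u ≠ N.sink l) {x x' : ι → Bool}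
    (hout : ∀ j, x j = x' j ∨ (j ∈ A1 ∧ ∃ a, N.src a = N.source j ∧ N.tgt a = u ∧
      ∃ y y' : ι → Bool, c.val a y ≠ c.val a y'))
    (hU : ∀ b, N.src b = u → (∀ l, N.tgt b ≠ N.sink l) → c.val b x = c.val b x')
    (b : N.A) (hbM : ∀ j, N.src b ≠ N.source j) (hbu : N.src b ≠ u) : c.val b x = c.val b x' := by
  suffices h : ∀ (q : ℕ) (b : N.A), N.rank (N.src b) = q → (∀ j, N.src b ≠ N.source j) →
      N.src b ≠ u → c.val b x = c.val b x' from h _ b rfl hbM hbu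
  intro q
  induction q using Nat.strong_induction_on with
  | _ q ih =>
    intro b hq hbM hbu
    refine c.local_ b x x' (fun a ha => ?_) (fun j hj => absurd hj.symm (hbM j))
    -- the head of `a` is the middle vertex `src b`
    have haM : ∀ l, N.tgt a ≠ N.sink l := fun l hl => N.sink_out b l (ha.symm.trans hl)
    by_cases hsa : ∃ j, N.src a = N.source j
    · obtain ⟨j, hj⟩ := hsa
      by_cases heff : ∃ y y' : ι → Bool, c.val a y ≠ c.val a y'
      · rcases hout j with hxj | ⟨hjA, a₁, ha₁, ha₁u, heff₁⟩
        · exact codingVolume_source_arc_depends c a hj x x' hxj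
        · -- `j` is in the block of `u`: its effective arcs all end at `u`, but `tgt a = src b ≠ u`
          exfalso
          have huM' : ∀ l, N.tgt a₁ ≠ N.sink l := fun l hl => huM l (ha₁u.symm.trans hl)
          exact hbu (ha.symm.trans ((hA1u j hjA a a₁ hj ha₁ haM huM' heff heff₁).trans ha₁u))
      · push Not at heff
        exact heff x x'
    · push Not at hsa
      by_cases hau : N.src a = u
      · exact hU a hau haM
      · have hlt : N.rank (N.src a) < q := by rw [← hq, ← ha]; exact N.rank_lt a
        exact ih _ hlt a rfl hsa hau

/-- **Inputs agreeing outside a block and on the arcs out of its entry vertex agree on the block**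
(`4`-far networks). With `A1`, `hA1u` as in `codingVolume_entry_lemmaM`, let `i ∈ A1` have the
effective arc `ai` from `source i` into the middle vertex `u = tgt ai`. If two inputs agree outside
the block of `u` and every arc from `u` into a non-sink carries the same bit on both, then they agree
on `x_i`: decode at `sink i` — its in-arcs come from middle vertices other than `u` (Lemma M; an arc
`u → sink i` would give distance `2`) or from sources outside the block (a source of the block
adjacent to `sink i` gives a walk `source i – u – source j – sink i` of length `3`). [folklore] -/
theorem codingVolume_entry_decode (c : N.Code) (hfar : N.Far 4) (A1 : Finset ι)
    (hA1u : ∀ j ∈ A1, ∀ a a', N.src a = N.source j → N.src a' = N.source j →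
      (∀ l, N.tgt a ≠ N.sink l) → (∀ l, N.tgt a' ≠ N.sink l) →
      (∃ y y' : ι → Bool, c.val a y ≠ c.val a y') → (∃ y y' : ι → Bool, c.val a' y ≠ c.val a' y') →
      N.tgt a = N.tgt a')
    (i : ι) {ai : N.A} (hai : N.src ai = N.source i) (haiM : ∀ l, N.tgt ai ≠ N.sink l)
    {x x' : ι → Bool}
    (hout : ∀ j, x j = x' j ∨ (j ∈ A1 ∧ ∃ a, N.src a = N.source j ∧ N.tgt a = N.tgt ai ∧
      ∃ y y' : ι → Bool, c.val a y ≠ c.val a y'))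
    (hU : ∀ b, N.src b = N.tgt ai → (∀ l, N.tgt b ≠ N.sink l) → c.val b x = c.val b x') :
    x i = x' i := by
  have h1 : N.graph.Adj (N.source i) (N.tgt ai) := by rw [← hai]; exact codingVolume_adj_arc ai
  refine c.decode i x x' (fun b hb => ?_)
  by_cases hsb : ∃ j, N.src b = N.source j
  · obtain ⟨j, hj⟩ := hsb
    rcases hout j with hxj | ⟨-, a, ha, hat, -⟩
    · exact codingVolume_source_arc_depends c b hj x x' hxj
    · -- `source i – tgt ai – source j – sink i` has length `3`
      exfalso
      have h2 : N.graph.Adj (N.source j) (N.tgt ai) := by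
        rw [← ha, ← hat]; exact codingVolume_adj_arc a
      have h3 : N.graph.Adj (N.source j) (N.sink i) := by
        rw [← hj, ← hb]; exact codingVolume_adj_arc b
      have hw := codingVolume_le_length_of_far (hfar i)
        (SimpleGraph.Walk.cons h1 (SimpleGraph.Walk.cons h2.symm
          (SimpleGraph.Walk.cons h3 SimpleGraph.Walk.nil)))
      simp at hw
  · push Not at hsb
    refine codingVolume_entry_lemmaM c A1 hA1u (N.tgt ai) (fun l => haiM l) hout hU b hsb
      (fun hbu => ?_)
    -- an arc `tgt ai → sink i` gives distance `2`
    have h2 : N.graph.Adj (N.tgt ai) (N.sink i) := by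
      rw [← hbu, ← hb]; exact codingVolume_adj_arc b
    have hw := codingVolume_le_length_of_far (hfar i)
      (SimpleGraph.Walk.cons h1 (SimpleGraph.Walk.cons h2 SimpleGraph.Walk.nil))
    simp at hw

/-- **DEPARTURE LEMMA (general one-shot codes).** Let `hr i` be the least rank of a middle vertex
receiving an effective arc from `source i` (`hrA`: attained, `hhr`: minimal), fix a level `r`, and
let `A1` be the set of level-`r` commodities entering the middle of the network at a SINGLE vertex
(`hA1`). In a `4`-far network, two inputs which agree on every commodity of level `< r` and on every
level-`r` commodity outside `A1`, and on which every arc from a rank-`r` middle vertex into a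
non-sink carries the same bit, agree on all of `A1`. Proof (hybrid argument): for `i ∈ A1` with
entry vertex `u`, the input `x''` equal to `x` on the block of `u` and to `x'` elsewhere has the same
bits as `x` on the arcs out of `u` (out-support: they only depend on the block of `u` and on agreed
commodities), hence the same as `x'`; and `x''`, `x'` agree outside the block, so
`codingVolume_entry_decode` gives `x'' i = x' i`. [folklore] -/
theorem codingVolume_departure (c : N.Code) (hfar : N.Far 4) (hr : ι → ℕ)
    (hrA : ∀ i, ∃ a, N.src a = N.source i ∧ (∀ l, N.tgt a ≠ N.sink l) ∧
      (∃ y y' : ι → Bool, c.val a y ≠ c.val a y') ∧ N.rank (N.tgt a) = hr i)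
    (hhr : ∀ i a, N.src a = N.source i → (∀ l, N.tgt a ≠ N.sink l) →
      (∃ y y' : ι → Bool, c.val a y ≠ c.val a y') → hr i ≤ N.rank (N.tgt a))
    (r : ℕ) (A1 : Finset ι)
    (hA1 : ∀ j, j ∈ A1 ↔ hr j = r ∧ ∀ a a', N.src a = N.source j → N.src a' = N.source j →
      (∀ l, N.tgt a ≠ N.sink l) → (∀ l, N.tgt a' ≠ N.sink l) →
      (∃ y y' : ι → Bool, c.val a y ≠ c.val a y') → (∃ y y' : ι → Bool, c.val a' y ≠ c.val a' y') →
      N.tgt a = N.tgt a')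
    {x x' : ι → Bool} (hB : ∀ j, hr j < r → x j = x' j)
    (hC : ∀ j, hr j = r → j ∉ A1 → x j = x' j)
    (hU : ∀ b, (∀ j, N.src b ≠ N.source j) → N.rank (N.src b) = r → (∀ l, N.tgt b ≠ N.sink l) →
      c.val b x = c.val b x')
    (i : ι) (hi : i ∈ A1) : x i = x' i := by
  classical
  have hA1u : ∀ j ∈ A1, ∀ a a', N.src a = N.source j → N.src a' = N.source j →
      (∀ l, N.tgt a ≠ N.sink l) → (∀ l, N.tgt a' ≠ N.sink l) →
      (∃ y y' : ι → Bool, c.val a y ≠ c.val a y') → (∃ y y' : ι → Bool, c.val a' y ≠ c.val a' y') →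
      N.tgt a = N.tgt a' := fun j hj => ((hA1 j).mp hj).2
  obtain ⟨ai, hai, haiM, haie, hrk⟩ := hrA i
  have hir : hr i = r := ((hA1 i).mp hi).1
  -- the entry vertex `u = tgt ai`: a middle vertex of rank `r`
  have huS : ∀ j, N.tgt ai ≠ N.source j := fun j h => N.source_in ai j h
  have hur : N.rank (N.tgt ai) = r := hrk.trans hir
  -- the hybrid input
  let x'' : ι → Bool := fun j =>
    if j ∈ A1 ∧ ∃ a, N.src a = N.source j ∧ N.tgt a = N.tgt ai ∧
      ∃ y y' : ι → Bool, c.val a y ≠ c.val a y' then x j else x' j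
  have hxi : x'' i = x i := if_pos ⟨hi, ai, hai, rfl, haie⟩
  -- `x''` and `x'` agree outside the block of `u`
  have hout : ∀ j, x'' j = x' j ∨ (j ∈ A1 ∧ ∃ a, N.src a = N.source j ∧ N.tgt a = N.tgt ai ∧
      ∃ y y' : ι → Bool, c.val a y ≠ c.val a y') := by
    intro j
    by_cases h : j ∈ A1 ∧ ∃ a, N.src a = N.source j ∧ N.tgt a = N.tgt ai ∧
        ∃ y y' : ι → Bool, c.val a y ≠ c.val a y'
    · exact Or.inr h
    · exact Or.inl (if_neg h)
  -- `x''` and `x` agree on the block of `u` and on every agreed commodity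
  have hin : ∀ j, ((∃ a, N.src a = N.source j ∧ N.tgt a = N.tgt ai ∧
      ∃ y y' : ι → Bool, c.val a y ≠ c.val a y') ∨ hr j < r) → x'' j = x j := by
    intro j hj
    by_cases h : j ∈ A1 ∧ ∃ a, N.src a = N.source j ∧ N.tgt a = N.tgt ai ∧
        ∃ y y' : ι → Bool, c.val a y ≠ c.val a y'
    · exact if_pos h
    · rw [show x'' j = x' j from if_neg h]
      rcases hj with ⟨a, ha, hat, hae⟩ | hj
      · -- an effective arc `source j → u`: `hr j ≤ r`
        have hle : hr j ≤ r := by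
          have := hhr j a ha (fun l hl => haiM l (hat ▸ hl)) hae
          rwa [hat, hur] at this
        rcases hle.lt_or_eq with hlt | heq
        · exact (hB j hlt).symm
        · have hjA : j ∉ A1 := fun hjA => h ⟨hjA, a, ha, hat, hae⟩
          exact (hC j heq hjA).symm
      · exact (hB j hj).symm
  -- hence the arcs out of `u` carry the same bits on `x''`, `x`, `x'`
  have hU'' : ∀ b, N.src b = N.tgt ai → (∀ l, N.tgt b ≠ N.sink l) → c.val b x'' = c.val b x' := by
    intro b hbu hbM
    have hbS : ∀ j, N.src b ≠ N.source j := fun j h => huS j (hbu ▸ h)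
    rw [← hU b hbS (hbu ▸ hur) hbM]
    exact codingVolume_val_eq_of_agree_entry c hr hhr r b hbS (hbu ▸ hur)
      (fun j hj => hin j (by rwa [hbu] at hj))
  rw [← hxi]
  exact codingVolume_entry_decode c hfar A1 hA1u i hai haiM hout hU''

end Departure

end Summit.PneNP.PneNP.Theorems
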